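import Literature.MathematicalPhysics.QuantumFieldTheory.Balaban1983to89.B9WalkLettersCoordsS

/-!
# `Balaban1983to89.B9WalkLettersKernels` — W-a FILE C-2 (part 2b, definitions): THE LOCATED BLOCK KERNELS of the rows-18 walk letters (3.87)–(3.90)
# at node00-def-Y's members — the coefficient kernels `KP KC KPD KCD KPL KCL KPt KCt KCLt` (and the per-direction `KPd KPLd KPtd`) of the N06
# certificate's `B9Thm37Whole.Ops ∕ B9Thm37WholeDir.DirLetters37` records, READ OFF THE SIZES OF THE PARTITION OF UNITY `h_□`

statement-level skeleton of published theorems with citation tags; proofs where landed; nothing here is a claim about the Yang–Mills mass gap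

B9 = T. Bałaban, *Propagators for lattice gauge theories in a background field*, Commun. Math. Phys. **99** (1985) 389–434 [Balaban1985BackgroundPropagators];
[4] = T. Bałaban, *Propagators and renormalization transformations for lattice gauge theories. II*, Commun. Math. Phys. **96** (1984) 223–250 [Balaban1984PropagatorsII].
THE PRINT.  (3.88)–(3.89) p.409: `K(h_□) = Σ_{b∈st(x)} (∂h_□)(b)·(D_U ·)(b) + (Δh_□)(x)· + (averaging line)`, «K(h_□) is a semi-local operator of size O(M⁻¹)»;
[4] (2.39)–(2.44) pp.229–230: the same letters for the scalar walk, «|∂h_□| ≦ O(1)(MLʲη)⁻¹, |Δh_□| ≦ O(1)(MLʲη)⁻²» (p.247), and the block-majorant currency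
(2.51) p.232 «|(Tλ)(x)| ≦ K(y, y′)|λ|, x ∈ Δ(y), supp λ ⊂ Δ(y′)».
WHY THIS FILE (pub-ymgap, dag-n06-d W-a C-2 programme; HOME `W-a-C2-PLAN.md` §5).  The N06 certificate (`Summit…N06AtOpsYNuOfRecordV6EPairOA`, edition 46)
displays the walk letters `𝔬 𝔡 𝔩` of rows 18 together with `hst : ∀ x, StaticOK (𝔬 x) ρ N_c N′ C_ℓ (κ x)` — 27 clauses `K*_nonneg ∕ K*_loc ∕ K*_row|col` on
the nine coefficient kernels — and `Identities₂ …` whose clauses `hP hPL hPt hC hCt hCL hCD hCLt` ask for block majorants of the letters by these kernels.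
Part 2a (`B9WalkLettersCoordsDom`, p662348) proved the dominations for ANY kernel `K` bounding the stencil sizes; this file NAMES the kernels of record:
* §1 the three sizes of `h_□` at a cube `c` of level `j`: `stepY x c = C1F∕(8∕5·S_j)` (one lattice step, `S_j = M_h·L^{j+1}`; r03 `abs_hT_sub_le_near`),
  `lapStepY x c = C2F∕(8∕5·S_j)²` (one second difference; r03 `abs_hT_second_diff_le`), `avgLipY x = sLipT∕(L·M_h)` (inside one averaging block; M5.7
  `abs_hTY_sub_le_of_avgCoeffY_ne_zero`) — print's `O(1)(MLʲη)⁻¹`, `O(1)(MLʲη)⁻²` in lattice units;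
* §2 the localisation indicator `locY x bI c a y″ = 𝟙[a ∈ S_□(c)]·𝟙[d(a, y″) ≤ 3]` (`S_□ = SblkY x bI c` of part C-1; radius `3` = one lattice step read
  through a 1-faithful site pin, n06-l `dist_sIK_le_distB_add_two`) and the two kernel shapes `rowKY C c a y″ = C(a)·locY a y″` (located at the OUTPUT block;
  the row-summed kernels `KP KC KPD KCD KPL KCL`) and `colKY C c y″ b = C(b)·locY b y″` (located at the INPUT block; the column-summed `KPt KCt KCLt`);
* §3 the coefficients (`CB := coordBound39 b·basisBound39 b` of the coordinate reading, the models' prefactors `(η·c_R)⁻¹`, `(η²·c_R)⁻¹`, `η⁻¹`, `η⁻²` of part 1):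
  `coefPY = (η c_R)⁻¹·CB·2·stepY`, `coefPLY = η⁻¹·CB·2·stepY`, `coefCY a = (η² c_R)⁻¹·CB·((d+1)·lapStepY + (η∕ℓ(a))²·avgLipY)` (the averaging line carries
  print's `a_j(Lʲη)⁻²`, [4] (2.14)), `coefCLY = η⁻²·CB·(d+1)·lapStepY`, `coefCDY = η⁻¹·CB·(d+1)·stepY`;
* §4 THE KERNELS `kPdY kPY kPtdY kPtY kPLdY kPLY kCY kCtY kCLY kCDY kCLtY kPDY (:= 0)` and the bookkeeping every `StaticOK.K*_nonneg ∕ K*_loc` clause needs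
  (`rowKY_nonneg ∕ colKY_nonneg`, `rowKY_loc ∕ colKY_loc`: a non-zero entry has `d ≤ 3`, `rowKY_eq_zero_of_not_mem ∕ colKY_eq_zero_of_not_mem`).
The dominations at these kernels, the row ∕ column sums (`StaticOK.K*_row ∕ K*_col`, print's `O(M⁻¹)`) and the record `opsWalkY` are parts 2b-S and 3.
HONEST SCOPE.  Definitions with bodies + bookkeeping; no (3.42), no regime, nothing of [B9]'s analysis asserted; count-neutral; N06 NOT discharged; nothing continuum ∕
OS ∕ mass gap ∕ Clay.  Cell `pub-ymgap` (D-0062), node N06 [B9], rows 18, seat `pub-ymgap-dag-n06-d` (gen 14).  Net new unproved facts: 0.  NEW file.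
-/

noncomputable section

namespace Literature.MathematicalPhysics.QuantumFieldTheory.Balaban1983to89.B9WalkLettersKernels

open Node00
open B6KLevelCensusIndexV1 (KIdx)
open B6MultiLevelBoxOperator (bigSide one_le_bigSide)
open B6Cover236MultiLevelBlocks (cubes)
open B6Partition118KLevelFineSizes (C1F C1F_nonneg)
open B6Partition118KLevelFineSecond (C2F C2F_nonneg)
open B6Partition118KLevelTorusBinders (sLipT sLipT_nonneg)
open B9Thm39ReadingCoords (cR39 cR39_nonneg coordBound39 basisBound39)
open B9Ineq349SiteComposite (etaS_pos)
open B9PinMembersKLevelV1 (MemberY geo9Y)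
open B9GeoLemma21KLevelV1 (geo9K_dist_comm)
open B9WalkLettersCoordsS (SblkY)

variable {d ℓ : ℕ} {hd : 1 ≤ d + 1} {hL : Odd (ℓ + 1) ∧ 1 < ℓ + 1} {b₀ b₁ : ℝ} {Mstar : ℕ}
variable {𝔸 : Type} [NormedRing 𝔸] [NormedAlgebra ℂ 𝔸] [FiniteDimensional ℝ 𝔸] {κ : Type} [Fintype κ]
variable (x : MemberY d ℓ hd hL b₀ b₁ Mstar) (b : Module.Basis κ ℝ 𝔸) (bI : FBondY x.toKIdx → IBondY x.toKIdx)

/-! ## §1 The sizes of the partition of unity `h_□` at a cube -/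

/-- **the one-step size of `h_□`** at a cube `c` of level `j`: `C1F∕(8∕5·S_j)`, `S_j = M_h·L^{j+1}` (print: `|∂h_□| ≦ O(1)(MLʲη)⁻¹`).
[cite: Balaban1984PropagatorsII, p.247 («|∂h_□| ≦ O(1)(MLʲη)⁻¹»), (2.40) p.230; Balaban1985BackgroundPropagators, (3.89) p.409] -/
def stepY (c : ↥(cubes x.toKIdx.D.toDomains)) : ℝ := C1F d ℓ / (8 / 5 * (bigSide ℓ x.toKIdx.Mh c.1.1 : ℝ))

/-- **the second-difference size of `h_□`** at a cube of level `j`: `C2F∕(8∕5·S_j)²` (print: `|Δh_□| ≦ O(1)(MLʲη)⁻²`).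
[cite: Balaban1984PropagatorsII, p.247, (2.40) p.230; Balaban1985BackgroundPropagators, (3.89) p.409] -/
def lapStepY (c : ↥(cubes x.toKIdx.D.toDomains)) : ℝ := C2F d ℓ / (8 / 5 * (bigSide ℓ x.toKIdx.Mh c.1.1 : ℝ)) ^ 2

/-- **the oscillation of `h_□` inside one averaging block**: `sLipT∕(L·M_h)` (the second line of (3.88): «h_□(z) − h_□(w), w ∈ Bʲ(y)»).
[cite: Balaban1985BackgroundPropagators, (3.88) p.409; Balaban1984PropagatorsII, p.247] -/
def avgLipY : ℝ := sLipT d ℓ / (((ℓ : ℝ) + 1) * x.toKIdx.Mh)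

/-- `0 < 8∕5·S_j`. [cite: Balaban1984PropagatorsII, (2.36) p.229, bookkeeping] -/
theorem bigSide_scaled_pos (j : ℕ) : (0 : ℝ) < 8 / 5 * (bigSide ℓ x.toKIdx.Mh j : ℝ) := by
  have h1 : 1 ≤ bigSide ℓ x.toKIdx.Mh j := one_le_bigSide (le_trans (by norm_num) x.toKIdx.hM8) j
  have h2 : (1 : ℝ) ≤ (bigSide ℓ x.toKIdx.Mh j : ℝ) := by exact_mod_cast h1
  linarith

/-- `0 ≤ stepY`. [cite: Balaban1984PropagatorsII, p.247, bookkeeping] -/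
theorem stepY_nonneg (c : ↥(cubes x.toKIdx.D.toDomains)) : 0 ≤ stepY x c :=
  div_nonneg (C1F_nonneg d ℓ) (bigSide_scaled_pos x c.1.1).le

/-- `0 ≤ lapStepY`. [cite: Balaban1984PropagatorsII, p.247, bookkeeping] -/
theorem lapStepY_nonneg (c : ↥(cubes x.toKIdx.D.toDomains)) : 0 ≤ lapStepY x c :=
  div_nonneg (C2F_nonneg d ℓ) (pow_nonneg (bigSide_scaled_pos x c.1.1).le 2)

/-- `0 ≤ avgLipY`. [cite: Balaban1984PropagatorsII, p.247, bookkeeping] -/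
theorem avgLipY_nonneg : 0 ≤ avgLipY x := by
  unfold avgLipY
  exact div_nonneg (sLipT_nonneg d ℓ) (mul_nonneg (by positivity) (Nat.cast_nonneg _))

/-! ## §2 The localisation indicator and the two kernel shapes -/

open Classical in
/-- **the localisation indicator** `𝟙[a ∈ S_□(c)]·𝟙[d(a, y″) ≤ 3]`: the kernels of `K(h_□)` are supported on pairs of blocks near `□̃(c)` at block distance
`≤ 3` (the stencil of (3.88) is one lattice step, read through the certificate's 1-faithful site pin). [cite: Balaban1985BackgroundPropagators, (3.88)–(3.89) p.409; Balaban1984PropagatorsII, (2.45)–(2.46) p.231] -/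
def locY (c : ↥(cubes x.toKIdx.D.toDomains)) (a y'' : (geo9Y x).Site) : ℝ :=
  if a ∈ SblkY x bI c ∧ (geo9Y x).dist a y'' ≤ 3 then 1 else 0

/-- **row-type located kernel** (`KP KC KPD KCD KPL KCL`): a coefficient at the OUTPUT block times the indicator. [cite: Balaban1984PropagatorsII, (2.39)–(2.44) pp.229–230, (2.51) p.232] -/
def rowKY (C : (geo9Y x).Site → ℝ) (c : ↥(cubes x.toKIdx.D.toDomains)) (a y'' : (geo9Y x).Site) : ℝ := C a * locY x bI c a y''

/-- **column-type located kernel** (`KPt KCt KCLt`, kernel `K y″ b`): a coefficient at the INPUT block `b` times the indicator at `b`.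
[cite: Balaban1984PropagatorsII, (2.39)–(2.44) pp.229–230, (2.51) p.232; Balaban1985BackgroundPropagators, (3.88) p.409 (transposed form)] -/
def colKY (C : (geo9Y x).Site → ℝ) (c : ↥(cubes x.toKIdx.D.toDomains)) (y'' a : (geo9Y x).Site) : ℝ := C a * locY x bI c a y''

omit [NormedAlgebra ℂ 𝔸] [FiniteDimensional ℝ 𝔸] [Fintype κ] in
/-- `0 ≤ locY ≤ 1`. [cite: Balaban1984PropagatorsII, (2.51) p.232, bookkeeping] -/
theorem locY_nonneg_le_one (c : ↥(cubes x.toKIdx.D.toDomains)) (a y'' : (geo9Y x).Site) : 0 ≤ locY x bI c a y'' ∧ locY x bI c a y'' ≤ 1 := by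
  unfold locY; split_ifs <;> norm_num

omit [NormedAlgebra ℂ 𝔸] [FiniteDimensional ℝ 𝔸] [Fintype κ] in
/-- the indicator vanishes off `S_□(c)`. [cite: Balaban1985BackgroundPropagators, (3.89) p.409, bookkeeping] -/
theorem locY_eq_zero_of_not_mem (c : ↥(cubes x.toKIdx.D.toDomains)) {a : (geo9Y x).Site} (ha : a ∉ SblkY x bI c) (y'' : (geo9Y x).Site) :
    locY x bI c a y'' = 0 := by
  unfold locY; rw [if_neg (fun h => ha h.1)]

omit [NormedAlgebra ℂ 𝔸] [FiniteDimensional ℝ 𝔸] [Fintype κ] in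
/-- the indicator vanishes beyond block distance `3`. [cite: Balaban1984PropagatorsII, (2.46) p.231, bookkeeping] -/
theorem locY_eq_zero_of_dist (c : ↥(cubes x.toKIdx.D.toDomains)) {a y'' : (geo9Y x).Site} (h : ¬ (geo9Y x).dist a y'' ≤ 3) : locY x bI c a y'' = 0 := by
  unfold locY; rw [if_neg (fun h' => h h'.2)]

omit [NormedAlgebra ℂ 𝔸] [FiniteDimensional ℝ 𝔸] [Fintype κ] in
/-- the indicator is `1` on its support. [cite: Balaban1984PropagatorsII, (2.46) p.231, bookkeeping] -/
theorem locY_eq_one (c : ↥(cubes x.toKIdx.D.toDomains)) {a y'' : (geo9Y x).Site} (ha : a ∈ SblkY x bI c) (h : (geo9Y x).dist a y'' ≤ 3) :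
    locY x bI c a y'' = 1 := by
  unfold locY; rw [if_pos ⟨ha, h⟩]

omit [NormedAlgebra ℂ 𝔸] [FiniteDimensional ℝ 𝔸] [Fintype κ] in
/-- a row-type kernel with a non-negative coefficient is non-negative (`StaticOK.K*_nonneg`). [cite: Balaban1984PropagatorsII, (2.39)–(2.44) pp.229–230, bookkeeping] -/
theorem rowKY_nonneg {C : (geo9Y x).Site → ℝ} (hC : ∀ a, 0 ≤ C a) (c : ↥(cubes x.toKIdx.D.toDomains)) (a y'' : (geo9Y x).Site) :
    0 ≤ rowKY x bI C c a y'' :=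
  mul_nonneg (hC a) (locY_nonneg_le_one x bI c a y'').1

omit [NormedAlgebra ℂ 𝔸] [FiniteDimensional ℝ 𝔸] [Fintype κ] in
/-- a column-type kernel with a non-negative coefficient is non-negative. [cite: Balaban1984PropagatorsII, (2.39)–(2.44) pp.229–230, bookkeeping] -/
theorem colKY_nonneg {C : (geo9Y x).Site → ℝ} (hC : ∀ a, 0 ≤ C a) (c : ↥(cubes x.toKIdx.D.toDomains)) (y'' a : (geo9Y x).Site) :
    0 ≤ colKY x bI C c y'' a :=
  mul_nonneg (hC a) (locY_nonneg_le_one x bI c a y'').1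

omit [NormedAlgebra ℂ 𝔸] [FiniteDimensional ℝ 𝔸] [Fintype κ] in
/-- a row-type kernel has range `≤ 3` (`StaticOK.K*_loc` with `ρ = 3`). [cite: Balaban1985BackgroundPropagators, (3.89) p.409 («semi-local»); Balaban1984PropagatorsII, (2.46) p.231] -/
theorem rowKY_loc (C : (geo9Y x).Site → ℝ) (c : ↥(cubes x.toKIdx.D.toDomains)) {a y'' : (geo9Y x).Site} (h : rowKY x bI C c a y'' ≠ 0) :
    (geo9Y x).dist a y'' ≤ 3 := by
  by_contra h3; exact h (by rw [rowKY, locY_eq_zero_of_dist x bI c h3, mul_zero])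

omit [NormedAlgebra ℂ 𝔸] [FiniteDimensional ℝ 𝔸] [Fintype κ] in
/-- a column-type kernel has range `≤ 3`. [cite: Balaban1985BackgroundPropagators, (3.89) p.409; Balaban1984PropagatorsII, (2.46) p.231] -/
theorem colKY_loc (C : (geo9Y x).Site → ℝ) (c : ↥(cubes x.toKIdx.D.toDomains)) {y'' a : (geo9Y x).Site} (h : colKY x bI C c y'' a ≠ 0) :
    (geo9Y x).dist y'' a ≤ 3 := by
  by_contra h3
  refine h ?_
  rw [colKY, locY_eq_zero_of_dist x bI c (fun h' => h3 ?_), mul_zero]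
  rw [show (geo9Y x).dist y'' a = (geo9Y x).dist a y'' from geo9K_dist_comm x.toKIdx _ _]; exact h'

omit [NormedAlgebra ℂ 𝔸] [FiniteDimensional ℝ 𝔸] [Fintype κ] in
/-- a row-type kernel vanishes off `S_□(c)` (the `else 0` of `StaticOK.K*_row`). [cite: Balaban1985BackgroundPropagators, (3.89) p.409, bookkeeping] -/
theorem rowKY_eq_zero_of_not_mem (C : (geo9Y x).Site → ℝ) (c : ↥(cubes x.toKIdx.D.toDomains)) {a : (geo9Y x).Site} (ha : a ∉ SblkY x bI c)
    (y'' : (geo9Y x).Site) : rowKY x bI C c a y'' = 0 := by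
  rw [rowKY, locY_eq_zero_of_not_mem x bI c ha, mul_zero]

omit [NormedAlgebra ℂ 𝔸] [FiniteDimensional ℝ 𝔸] [Fintype κ] in
/-- a column-type kernel vanishes off `S_□(c)` in its input block. [cite: Balaban1985BackgroundPropagators, (3.89) p.409, bookkeeping] -/
theorem colKY_eq_zero_of_not_mem (C : (geo9Y x).Site → ℝ) (c : ↥(cubes x.toKIdx.D.toDomains)) (y'' : (geo9Y x).Site) {a : (geo9Y x).Site}
    (ha : a ∉ SblkY x bI c) : colKY x bI C c y'' a = 0 := by
  rw [colKY, locY_eq_zero_of_not_mem x bI c ha, mul_zero]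

omit [NormedAlgebra ℂ 𝔸] [FiniteDimensional ℝ 𝔸] [Fintype κ] in
/-- a row-type kernel is at most its coefficient (`locY ≤ 1`). [cite: Balaban1984PropagatorsII, (2.51) p.232, bookkeeping] -/
theorem rowKY_le_coef {C : (geo9Y x).Site → ℝ} (hC : ∀ a, 0 ≤ C a) (c : ↥(cubes x.toKIdx.D.toDomains)) (a y'' : (geo9Y x).Site) :
    rowKY x bI C c a y'' ≤ C a := by
  have h := (locY_nonneg_le_one x bI c a y'').2
  calc rowKY x bI C c a y'' = C a * locY x bI c a y'' := rfl
    _ ≤ C a * 1 := mul_le_mul_of_nonneg_left h (hC a)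
    _ = C a := mul_one _

/-! ## §3 The coefficients -/

/-- the constant of the coordinate reading: `CB := coordBound·basisBound` of the basis `b`. [cite: Balaban1985BackgroundPropagators, (3.39)–(3.41) p.397 (norms), bookkeeping] -/
def cbY : ℝ := coordBound39 b * basisBound39 b

/-- `0 ≤ CB`. [cite: Balaban1985BackgroundPropagators, (3.39)–(3.41) p.397, bookkeeping] -/
theorem cbY_nonneg : 0 ≤ cbY b := by
  unfold cbY coordBound39 basisBound39
  exact mul_nonneg (norm_nonneg _) (Finset.sum_nonneg fun _ _ => norm_nonneg _)

/-- **the coefficient of the `P`-letters** (`P_□,μ`, `Pᵗ_□,μ`): `(η·c_R)⁻¹·CB·2·stepY` (two stencil points, each one lattice step of `h_□`).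
[cite: Balaban1985BackgroundPropagators, (3.88)–(3.89) p.409; Balaban1984PropagatorsII, (2.39)–(2.40) pp.229–230] -/
def coefPY (c : ↥(cubes x.toKIdx.D.toDomains)) : (geo9Y x).Site → ℝ := fun _ => (etaS x.toKIdx * cR39 b)⁻¹ * (cbY b * (2 * stepY x c))

/-- **the coefficient of the Laplacian-Leibniz `P^L`-letters**: `η⁻¹·CB·2·stepY`. [cite: Balaban1985BackgroundPropagators, (3.88) p.409, (3.100) p.413] -/
def coefPLY (c : ↥(cubes x.toKIdx.D.toDomains)) : (geo9Y x).Site → ℝ := fun _ => (etaS x.toKIdx)⁻¹ * (cbY b * (2 * stepY x c))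

/-- **the coefficient of the `C`-letters** (`C_□`, `Cᵗ_□`): `(η²·c_R)⁻¹·CB·((d+1)·lapStepY + (η∕ℓ(a))²·avgLipY)` — the Laplacian line and the averaging line
of (3.88), the latter with print's weight `a_j(Lʲη)⁻²` of the block at `a` (`(η∕ℓ(a))² = L^{−2j(a)}`, `a_j ≤ 1`).
[cite: Balaban1985BackgroundPropagators, (3.88)–(3.89) p.409; Balaban1984PropagatorsII, (2.14) p.225, (2.39)–(2.40) pp.229–230] -/
def coefCY (c : ↥(cubes x.toKIdx.D.toDomains)) : (geo9Y x).Site → ℝ := fun a =>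
  (etaS x.toKIdx ^ 2 * cR39 b)⁻¹ * (cbY b * (((d : ℝ) + 1) * lapStepY x c + (etaS x.toKIdx / (geo9Y x).len a) ^ 2 * avgLipY x))

/-- **the coefficient of the `C^L`-letter** (`M_{Δh_□}`): `η⁻²·CB·(d+1)·lapStepY`. [cite: Balaban1985BackgroundPropagators, (3.88) p.409, (3.100) p.413] -/
def coefCLY (c : ↥(cubes x.toKIdx.D.toDomains)) : (geo9Y x).Site → ℝ := fun _ => (etaS x.toKIdx ^ 2)⁻¹ * (cbY b * (((d : ℝ) + 1) * lapStepY x c))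

/-- **the coefficient of the `∇`-Leibniz letters** (`C^D`, `C^{Lt}`): `η⁻¹·CB·(d+1)·stepY` (one stencil point per direction).
[cite: Balaban1985BackgroundPropagators, (3.100) p.413, (3.8) p.392; Balaban1984PropagatorsII, (2.39) p.229] -/
def coefCDY (c : ↥(cubes x.toKIdx.D.toDomains)) : (geo9Y x).Site → ℝ := fun _ => (etaS x.toKIdx)⁻¹ * (cbY b * (((d : ℝ) + 1) * stepY x c))

/-- `0 ≤ coefPY`. [cite: Balaban1984PropagatorsII, (2.39)–(2.40) pp.229–230, bookkeeping] -/
theorem coefPY_nonneg (c : ↥(cubes x.toKIdx.D.toDomains)) (a : (geo9Y x).Site) : 0 ≤ coefPY x b c a :=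
  mul_nonneg (inv_nonneg.2 (mul_nonneg (etaS_pos _).le (cR39_nonneg b))) (mul_nonneg (cbY_nonneg b) (by linarith [stepY_nonneg x c]))

/-- `0 ≤ coefPLY`. [cite: Balaban1984PropagatorsII, (2.39)–(2.40) pp.229–230, bookkeeping] -/
theorem coefPLY_nonneg (c : ↥(cubes x.toKIdx.D.toDomains)) (a : (geo9Y x).Site) : 0 ≤ coefPLY x b c a :=
  mul_nonneg (inv_nonneg.2 (etaS_pos _).le) (mul_nonneg (cbY_nonneg b) (by linarith [stepY_nonneg x c]))

/-- `0 ≤ coefCY`. [cite: Balaban1984PropagatorsII, (2.39)–(2.40) pp.229–230, bookkeeping] -/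
theorem coefCY_nonneg (c : ↥(cubes x.toKIdx.D.toDomains)) (a : (geo9Y x).Site) : 0 ≤ coefCY x b c a := by
  unfold coefCY
  have h1 := lapStepY_nonneg x c
  have h2 := avgLipY_nonneg x
  have h3 := cbY_nonneg b
  have h4 : 0 ≤ (etaS x.toKIdx ^ 2 * cR39 b)⁻¹ := inv_nonneg.2 (mul_nonneg (pow_nonneg (etaS_pos _).le 2) (cR39_nonneg b))
  have h5 : (0 : ℝ) ≤ (d : ℝ) + 1 := by positivity
  exact mul_nonneg h4 (mul_nonneg h3 (add_nonneg (mul_nonneg h5 h1) (mul_nonneg (sq_nonneg _) h2)))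

/-- `0 ≤ coefCLY`. [cite: Balaban1984PropagatorsII, (2.39)–(2.40) pp.229–230, bookkeeping] -/
theorem coefCLY_nonneg (c : ↥(cubes x.toKIdx.D.toDomains)) (a : (geo9Y x).Site) : 0 ≤ coefCLY x b c a := by
  unfold coefCLY
  have h1 := lapStepY_nonneg x c
  have h3 := cbY_nonneg b
  have h5 : (0 : ℝ) ≤ (d : ℝ) + 1 := by positivity
  exact mul_nonneg (inv_nonneg.2 (pow_nonneg (etaS_pos _).le 2)) (mul_nonneg h3 (mul_nonneg h5 h1))

/-- `0 ≤ coefCDY`. [cite: Balaban1984PropagatorsII, (2.39)–(2.40) pp.229–230, bookkeeping] -/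
theorem coefCDY_nonneg (c : ↥(cubes x.toKIdx.D.toDomains)) (a : (geo9Y x).Site) : 0 ≤ coefCDY x b c a := by
  unfold coefCDY
  have h1 := stepY_nonneg x c
  have h3 := cbY_nonneg b
  have h5 : (0 : ℝ) ≤ (d : ℝ) + 1 := by positivity
  exact mul_nonneg (inv_nonneg.2 (etaS_pos _).le) (mul_nonneg h3 (mul_nonneg h5 h1))

/-! ## §4 The kernels of record -/

/-- **`KPd □ μ`**, the per-direction kernel of `P_□,μ` (independent of `μ`). [cite: Balaban1985BackgroundPropagators, (3.88) p.409; Balaban1984PropagatorsII, (2.39)–(2.40) pp.229–230] -/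
def kPdY (c : ↥(cubes x.toKIdx.D.toDomains)) : Fin (d + 1) → (geo9Y x).Site → (geo9Y x).Site → ℝ := fun _ => rowKY x bI (coefPY x b c) c

/-- **`KP □ = (d+1)·KPd □`**, the kernel of `P_□ = Σ_μ P_□,μ`. [cite: Balaban1985BackgroundPropagators, (3.88) p.409; Balaban1984PropagatorsII, (2.39)–(2.40) pp.229–230] -/
def kPY (c : ↥(cubes x.toKIdx.D.toDomains)) : (geo9Y x).Site → (geo9Y x).Site → ℝ := fun a y'' => ((d : ℝ) + 1) * rowKY x bI (coefPY x b c) c a y''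

/-- **`KPtd □ μ`**, the per-direction kernel of the transposed letter `Pᵗ_□,μ` (column type). [cite: Balaban1985BackgroundPropagators, (3.88) p.409 (transposed form); Balaban1984PropagatorsII, (2.39)–(2.40) pp.229–230] -/
def kPtdY (c : ↥(cubes x.toKIdx.D.toDomains)) : Fin (d + 1) → (geo9Y x).Site → (geo9Y x).Site → ℝ := fun _ => colKY x bI (coefPY x b c) c

/-- **`KPt □ = (d+1)·KPtd □`**. [cite: Balaban1985BackgroundPropagators, (3.88) p.409; Balaban1984PropagatorsII, (2.39)–(2.40) pp.229–230] -/
def kPtY (c : ↥(cubes x.toKIdx.D.toDomains)) : (geo9Y x).Site → (geo9Y x).Site → ℝ := fun y'' a => ((d : ℝ) + 1) * colKY x bI (coefPY x b c) c y'' a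

/-- **`KPLd □ μ`**, the per-direction kernel of the Laplacian-Leibniz letter `P^L_□,μ`. [cite: Balaban1985BackgroundPropagators, (3.88) p.409, (3.100) p.413] -/
def kPLdY (c : ↥(cubes x.toKIdx.D.toDomains)) : Fin (d + 1) → (geo9Y x).Site → (geo9Y x).Site → ℝ := fun _ => rowKY x bI (coefPLY x b c) c

/-- **`KPL □ = (d+1)·KPLd □`**. [cite: Balaban1985BackgroundPropagators, (3.88) p.409, (3.100) p.413] -/
def kPLY (c : ↥(cubes x.toKIdx.D.toDomains)) : (geo9Y x).Site → (geo9Y x).Site → ℝ := fun a y'' => ((d : ℝ) + 1) * rowKY x bI (coefPLY x b c) c a y''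

/-- **`KC □`**, the kernel of `C_□` (Laplacian line + averaging line of (3.88)). [cite: Balaban1985BackgroundPropagators, (3.88)–(3.89) p.409; Balaban1984PropagatorsII, (2.39)–(2.40) pp.229–230] -/
def kCY (c : ↥(cubes x.toKIdx.D.toDomains)) : (geo9Y x).Site → (geo9Y x).Site → ℝ := rowKY x bI (coefCY x b c) c

/-- **`KCt □`**, the kernel of the transposed letter `Cᵗ_□` (column type, coefficient at the input block). [cite: Balaban1985BackgroundPropagators, (3.88) p.409 (transposed form); Balaban1984PropagatorsII, (2.39)–(2.40) pp.229–230] -/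
def kCtY (c : ↥(cubes x.toKIdx.D.toDomains)) : (geo9Y x).Site → (geo9Y x).Site → ℝ := colKY x bI (coefCY x b c) c

/-- **`KCL □`**, the kernel of `C^L_□ = −η⁻²M_{Δh_□}`. [cite: Balaban1985BackgroundPropagators, (3.88) p.409, (3.100) p.413] -/
def kCLY (c : ↥(cubes x.toKIdx.D.toDomains)) : (geo9Y x).Site → (geo9Y x).Site → ℝ := rowKY x bI (coefCLY x b c) c

/-- **`KCD □`**, the kernel of the `∇`-Leibniz letter `C^D(U, h_□)`. [cite: Balaban1985BackgroundPropagators, (3.100) p.413; Balaban1984PropagatorsII, (2.39) p.229] -/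
def kCDY (c : ↥(cubes x.toKIdx.D.toDomains)) : (geo9Y x).Site → (geo9Y x).Site → ℝ := rowKY x bI (coefCDY x b c) c

/-- **`KCLt □`**, the kernel of the right `∇*`-Leibniz letter `C^{Lt}(U, h_□)` (column type). [cite: Balaban1985BackgroundPropagators, (3.100) p.413, (3.8) p.392] -/
def kCLtY (c : ↥(cubes x.toKIdx.D.toDomains)) : (geo9Y x).Site → (geo9Y x).Site → ℝ := colKY x bI (coefCDY x b c) c

/-- **`KPD □ := 0`** (the letter `P^D := 0` of part 1: the `∇`-Leibniz rule has no first-order letter on the bond side). [cite: Balaban1985BackgroundPropagators, (3.100) p.413] -/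
def kPDY (_c : ↥(cubes x.toKIdx.D.toDomains)) : (geo9Y x).Site → (geo9Y x).Site → ℝ := fun _ _ => 0

/-- `Σ_μ KPd □ μ = KP □` (the `Identities₂.KPd_sum` clause, with equality). [cite: Balaban1985BackgroundPropagators, (3.88) p.409, bookkeeping] -/
theorem sum_kPdY (c : ↥(cubes x.toKIdx.D.toDomains)) (a y'' : (geo9Y x).Site) : (∑ μ, kPdY x b bI c μ a y'') = kPY x b bI c a y'' := by
  unfold kPdY kPY; rw [Finset.sum_const, Finset.card_univ, Fintype.card_fin, nsmul_eq_mul]; push_cast; ring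

/-- `Σ_μ KPtd □ μ = KPt □`. [cite: Balaban1985BackgroundPropagators, (3.88) p.409, bookkeeping] -/
theorem sum_kPtdY (c : ↥(cubes x.toKIdx.D.toDomains)) (y'' a : (geo9Y x).Site) : (∑ μ, kPtdY x b bI c μ y'' a) = kPtY x b bI c y'' a := by
  unfold kPtdY kPtY; rw [Finset.sum_const, Finset.card_univ, Fintype.card_fin, nsmul_eq_mul]; push_cast; ring

/-- `Σ_μ KPLd □ μ = KPL □`. [cite: Balaban1985BackgroundPropagators, (3.88) p.409, bookkeeping] -/
theorem sum_kPLdY (c : ↥(cubes x.toKIdx.D.toDomains)) (a y'' : (geo9Y x).Site) : (∑ μ, kPLdY x b bI c μ a y'') = kPLY x b bI c a y'' := by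
  unfold kPLdY kPLY; rw [Finset.sum_const, Finset.card_univ, Fintype.card_fin, nsmul_eq_mul]; push_cast; ring

end Literature.MathematicalPhysics.QuantumFieldTheory.Balaban1983to89.B9WalkLettersKernels

end
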